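import Literature.NumberTheory.EllipticCurves.KubertTwoTen
import Literature.NumberTheory.EllipticCurves.TwoIsogenyDescent
import Literature.NumberTheory.EllipticCurves.MordellWeilTheoremProofs
import Literature.NumberTheory.EllipticCurves.CanonicalPAdicHeightLeavesProofs
import Literature.NumberTheory.EllipticCurves.KramerTwoDescentValuation
import Literature.NumberTheory.EllipticCurves.KramerTwoDescentSquares
import HarnessLib

/-!
# Kubert (1976), no `ℤ/2ℤ × ℤ/10ℤ` in `E(ℚ)`: the rational points of `X₁(2,10)` and the
# discharge `Kubert1976_no_two_ten_holds`

Topic `NumberTheory/EllipticCurves`; sibling proof file of `MazurTorsion.lean` (named fact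
`Kubert1976_no_two_ten W`: D. S. Kubert, *Universal bounds on the torsion of elliptic curves*,
Proc. London Math. Soc. (3) 33 (1976) 193–237, Ch. IV — `X₁(2,10)(ℚ)` is cuspidal; Mazur 1977,
Ch. III §5, p. 156) and of `KubertTwoTen.lean`, which reduces that fact to: every rational solution
of `y² = x³ + x² - x` has `x ∈ {0, 1, -1}`. This file PROVES the latter (`X1TwoTen_points`) and
hence the fact (`Kubert1976_no_two_ten_holds`). Everything is a theorem; no named fact and no new
definition is introduced (the curve is used through the literal `⟨0, 1, 0, -1, 0⟩`).

## The determination of `X₁(2,10)(ℚ)` (curve `y² = x³ + x² - x`, conductor `20`, class `20A`)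

1. **Rank `0` by descent via `2`-isogeny** (`finite_point_X1TwoTen`; `TwoIsogenyDescent.lean`,
   Silverman–Tate III.5–6, *AEC* X.4.9): with `T = (0,0)`, `b = -1`, `a = 1`, the isogenous curve
   is `Y² = X³ - 2X² + 5X`. On the first curve every `x ≠ 0` has all `p`-adic valuations even
   (`even_padicValRat_of_twoTorsionNF`, `p ∤ b = -1`), so `x` or `-x` is a square
   (`α ⊆ {[1],[-1]}`); on the second `X > 0` (`X³ - 2X² + 5X = X((X-1)² + 4)`) and `v_p(X)` is even
   for `p ≠ 5`, so `X` or `5X` is a square (`α' ⊆ {[1],[5]}`). Hence `E(ℚ) = 2E(ℚ) + {O, T}`, and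
   `E(ℚ)` is finite by the tree's Mordell–Weil theorem.
2. **Torsion**: `T` is the only rational `2`-torsion point (`x² + x - 1` has no rational root,
   `5`-adically) and `2Q ≠ T` for all `Q` (duplication formula: `x(2Q)(2y)² = (x² + 1)²`), so the
   double `2Q` of any point has odd order; an odd-order point `P₀ = (x₀, y₀)` has `‖x₀‖_p ≤ 1` at
   every prime — at `p = 2` by the integrality of prime-to-`p` torsion
   (`val_le_one_of_zsmul_eq_zero`, *AEC* VII.3.1, tree `GoodReductionInertia.lean`), at odd `p` by
   the torsion-freeness of `E₁(ℚ_p) ∩ E(ℚ)` (*AEC* VII.3.4; the tree's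
   `not_isOfFinAddOrder_of_one_lt_padicNorm_holds`, re-proved here for `ℤ`-integral rather than
   globally minimal equations) — so `x₀ ∈ ℤ`; and `x₀ = w²` (duplication formula), `w ∈ ℤ`,
   `v = y₀/w ∈ ℤ` with `v² = w⁴ + w² - 1`, forcing `w² = 1` (`u² < u² + u - 1 < (u+1)²`).
3. Every point is `2Q` or `2Q + T` (`X1TwoTen_exists_eq_two_smul_or`), whence
   `x ∈ {0, 1, -1}` (`X1TwoTen_points`): the six points `O, (0,0), (1,±1), (-1,±1)`, the six
   rational cusps of `X₁(2,10)` (Cremona, Table 1, `20A`: `r = 0`, `|T| = 6`).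

## References

* [Kubert1976] D. S. Kubert, Proc. London Math. Soc. (3) 33 (1976) 193–237, Ch. IV.
* [Mazur1977] B. Mazur, Publ. Math. IHÉS 47 (1977), Ch. III §5, p. 156.
* [SilvermanAEC2009] J. H. Silverman, *The Arithmetic of Elliptic Curves*, 2nd ed.: III.2.3(d)
  (duplication), VII.3.1, VII.3.4 (torsion and reduction), VIII.6.7 (Mordell–Weil), X.4.9
  (descent via two-isogeny).
* J. H. Silverman, J. Tate, *Rational Points on Elliptic Curves* (1992), III.5–III.6 (not held).
* [CremonaAlgorithms1997] J. E. Cremona, *Algorithms for Modular Elliptic Curves*, Table 1,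
  `N = 20` (consistency check only; not used in proofs).

## Design

* The `ℚ`-points of the literal curve carry Mathlib's group law elaborated with `ℚ`'s decidable
  equality, as in the statement of `Kubert1976_no_two_ten`; the generic files
  (`IsogenyTwoTorsionProofs`, `TwoIsogenyDescent`, `MordellWeilTheoremProofs`,
  `GoodReductionInertia`) use the classical instance. The two group laws agree
  (`point_add_irrel`, `point_zsmul_irrel` of the tree); the only statements crossing the border
  are `X1TwoTen_exists_eq_two_smul_or` and the `2`-adic integrality step, bridged explicitly.
* `IsElliptic`, `IsIntegral ℤ` for the literal curve and `Fact (Nat.Prime 5)` are theorems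
  supplied by `haveI` where needed (no instances are registered).
-/

noncomputable section

open scoped Classical NNReal

/-! ### `E₁(ℚ_p) ∩ E(ℚ)` is torsion-free for `p` odd, for any `ℤ`-integral equation -/

namespace WeierstrassCurve

open Literature.NumberTheory.EllipticCurves Polynomial

/-- **`E(ℚ) ∩ E₁(ℚ_p)` has no torsion for `p` odd, on any `ℤ`-integral Weierstrass equation**
(Silverman, *AEC*, VII.3.4 / IV.6.1 over `ℚ_p`). This is the tree's
`not_isOfFinAddOrder_of_one_lt_padicNorm_holds` (`CanonicalPAdicHeightLeavesProofs.lean`) with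
its hypothesis `IsGloballyMinimal` weakened to `IsIntegral ℤ`, which is all its proof uses
(verbatim): a torsion point of `E₁` has a multiple `R = (x', y') ∈ E₁` of prime order `q`; for
`q ≠ p` this contradicts `val_le_one_of_zsmul_eq_zero` (`ΨSq_q` has unit leading
coefficient), and for `q = p` odd, `ψ_p(R) = 0` with `ψ_p = p·x^{(p²-1)/2} + (integral lower
terms)` whose leading term dominates because `‖x'‖_p ≥ p²`.
[cite: SilvermanAEC2009, VII.3.4] -/
theorem not_isOfFinAddOrder_of_one_lt_padicNorm_of_isIntegral (W : WeierstrassCurve ℚ)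
    [W.IsElliptic] [W.IsIntegral ℤ] (p : ℕ) [Fact p.Prime] (hp : 3 ≤ p) {x y : ℚ}
    (h : W.toAffine.Nonsingular x y) (hx : 1 < ‖(x : ℚ_[p])‖) :
    ¬ IsOfFinAddOrder (.some x y h : W.toAffine.Point) := by
  intro hfin
  haveI : W.IsIntegral (ratAdicValuation p).integer := W.isIntegral_integer_ratAdicValuation p
  have hprime : p.Prime := Fact.out
  -- a multiple of prime order, still in `E₁`
  set P : W.toAffine.Point := .some x y h with hPdef
  have hN : 0 < addOrderOf P := hfin.addOrderOf_pos
  have hN1 : addOrderOf P ≠ 1 := by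
    rw [Ne, AddMonoid.addOrderOf_eq_one_iff]; exact WeierstrassCurve.Affine.Point.some_ne_zero h
  obtain ⟨q, hq, hqN⟩ := Nat.exists_prime_and_dvd hN1
  obtain ⟨m, hm⟩ := hqN
  have hm0 : m ≠ 0 := by rintro rfl; rw [mul_zero] at hm; omega
  have hmlt : m < addOrderOf P := by
    rw [hm]; exact lt_mul_left (Nat.pos_of_ne_zero hm0) hq.one_lt
  set R := m • P with hRdef
  have hR0 : R ≠ 0 := nsmul_ne_zero_of_lt_addOrderOf hm0 hmlt
  have hqR : q • R = 0 := by
    rw [hRdef, ← mul_nsmul, Nat.mul_comm m q, ← hm]; exact addOrderOf_nsmul_eq_zero P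
  have hRmem : R ∈ W.kernelOfReductionAt p :=
    AddSubgroup.nsmul_mem _ ((some_mem_kernelOfReductionAt_iff h).mpr hx) m
  rcases hR : R with _ | ⟨x', y', h'⟩
  · exact hR0 hR
  rw [hR] at hRmem hqR
  have hx' : 1 < ‖(x' : ℚ_[p])‖ := (some_mem_kernelOfReductionAt_iff h').mp hRmem
  have hqR' : (q : ℤ) • (.some x' y' h' : W.toAffine.Point) = 0 := by rw [natCast_zsmul]; exact hqR
  -- the same multiple for the classical `DecidableEq ℚ` instance of the generic files
  have hqR'' := (point_zsmul_irrel (instDecidableEqRat) (fun a b => Classical.propDecidable (a = b))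
    (q : ℤ) (.some x' y' h' : W.toAffine.Point)).symm.trans hqR'
  by_cases hqp : q = p
  · -- `q = p`: `ψ_p(x') = 0`, impossible by dominance of `p x'^{(p²-1)/2}`
    subst hqp
    have hΨ : (W.ΨSq q).eval x' = 0 := (W.zsmul_some_eq_zero_iff_eval_ΨSq h' q).mp hqR''
    have hodd : ¬ Even q := fun he => by
      have := hq.even_iff.mp he; omega
    rw [WeierstrassCurve.ΨSq_ofNat, if_neg hodd, mul_one, eval_pow, pow_eq_zero_iff two_ne_zero] at hΨ
    -- integrality, degree and leading coefficient of `preΨ' q`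
    set d := (q ^ 2 - 1) / 2 with hd
    have hdeg : (W.preΨ' q).natDegree ≤ d := by
      have := W.natDegree_preΨ'_le q; rwa [if_neg hodd] at this
    have hlead : (W.preΨ' q).coeff d = q := by
      have := W.coeff_preΨ' q; rw [if_neg hodd, if_neg hodd] at this; exact this
    have hcoeff : ∀ i, ratAdicValuation q ((W.preΨ' q).coeff i) ≤ 1 := fun i => by
      have hmap : W.preΨ' q = ((W.integralModel ℤ).preΨ' q).map (algebraMap ℤ ℚ) := by
        rw [← WeierstrassCurve.map_preΨ', ← WeierstrassCurve.baseChange,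
          WeierstrassCurve.baseChange_integralModel_eq]
      rw [hmap, coeff_map, ratAdicValuation_apply, ← NNReal.coe_le_coe, NNReal.coe_one, coe_nnnorm,
        eq_intCast, Rat.cast_intCast]
      exact Padic.norm_int_le_one _
    have hx1 : 1 ≤ ratAdicValuation q x' := by
      rw [ratAdicValuation_apply, ← NNReal.coe_le_coe, NNReal.coe_one, coe_nnnorm]; exact hx'.le
    have hdom : 1 < ratAdicValuation q ((W.preΨ' q).coeff d) * ratAdicValuation q x' := by
      rw [hlead, ratAdicValuation_apply, ratAdicValuation_apply, ← NNReal.coe_lt_coe, NNReal.coe_one,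
        NNReal.coe_mul, coe_nnnorm, coe_nnnorm, Rat.cast_natCast, Padic.norm_p]
      have hp0 : (0 : ℝ) < q := by exact_mod_cast hq.pos
      have h2q : (2 : ℝ) ≤ q := by exact_mod_cast hq.two_le
      have h2 := sq_le_norm_of_one_lt_norm h' hx'
      rw [inv_mul_eq_div, lt_div_iff₀ hp0, one_mul]
      nlinarith
    have hval := val_eval_eq_mul_pow hcoeff hdeg hx1 hdom
    rw [hΨ, map_zero] at hval
    have hc : 0 < ratAdicValuation q ((W.preΨ' q).coeff d) := by
      refine pos_of_ne_zero fun h0 => ?_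
      rw [h0, zero_mul] at hdom
      exact not_lt_of_ge zero_le_one hdom
    exact (mul_pos hc (pow_pos (zero_lt_one.trans_le hx1) d)).ne hval
  · -- `q ≠ p`: `ΨSq_q` has unit leading coefficient (`val_le_one_of_zsmul_eq_zero`)
    have hwq : ratAdicValuation p ((q : ℤ) : ℚ) = 1 := by
      rw [ratAdicValuation_apply, ← NNReal.coe_eq_one, coe_nnnorm, Int.cast_natCast, Rat.cast_natCast,
        Padic.norm_natCast_eq_one_iff]
      exact (Nat.coprime_primes hprime hq).mpr (Ne.symm hqp)
    have := Literature.NumberTheory.EllipticCurves.val_le_one_of_zsmul_eq_zero (V := W) hwq hqR''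
    rw [ratAdicValuation_apply, ← NNReal.coe_le_coe, NNReal.coe_one, coe_nnnorm] at this
    exact absurd hx' (not_lt.mpr this)

end WeierstrassCurve

namespace Literature.NumberTheory.EllipticCurves

open _root_.WeierstrassCurve KramerTwoDescent

/-! ### The curve `X₁(2,10) : y² = x³ + x² - x` -/

/-! **The curve.** `X₁(2,10)` is used through its literal Weierstrass model
`⟨0, 1, 0, -1, 0⟩ : WeierstrassCurve ℚ`, i.e. `y² = x³ + x² - x` (`Δ = 80 = 2⁴·5`, conductor
`20`; `2`-isogenous to `X₀(20)`, Cremona's isogeny class `20A`). It arises in `KubertTwoTen.lean`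
(`KubertTwoTen.exists_point_of_injective`) as the curve `S² = (2f - 1)(4f² - 2f - 1)`,
`x = 2f - 1`, over Kubert's parameter `f` of `X₁(10)`; its six rational points `O`, `(0, 0)`,
`(1, ±1)`, `(-1, ±1)` are the six rational cusps (`f = ∞, 1/2, 1, 0`). The lemmas about it are
named `X1TwoTen_…`; its `2`-torsion point `T = (0, 0)` is written
`Affine.Point.some 0 0 X1TwoTen_nonsingular_zero`. No coefficient lemmas are stated: the
coefficients `a₁ = 0, a₂ = 1, a₃ = 0, a₄ = -1, a₆ = 0` are projections of the literal, which
`simp`, `norm_num`, `field_simp`, `ring` and `linear_combination` reduce by themselves (after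
`toAffine_aᵢ` where the affine abbreviation intervenes). -/

/-- `Δ(X₁(2,10)) = 80`. [folklore] -/
theorem X1TwoTen_Δ : (⟨0, 1, 0, -1, 0⟩ : WeierstrassCurve ℚ).Δ = 80 := by
  norm_num [WeierstrassCurve.Δ, b₂, b₄, b₆, b₈]

/-- `X₁(2,10)` is an elliptic curve (`Δ = 80 ≠ 0`). [folklore] -/
theorem isElliptic_X1TwoTen : (⟨0, 1, 0, -1, 0⟩ : WeierstrassCurve ℚ).IsElliptic := ⟨by rw [X1TwoTen_Δ]; norm_num⟩

/-- The model has integer coefficients. [folklore] -/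
theorem isIntegral_X1TwoTen : (⟨0, 1, 0, -1, 0⟩ : WeierstrassCurve ℚ).IsIntegral ℤ :=
  ⟨⟨⟨0, 1, 0, -1, 0⟩, by ext <;> simp [baseChange, map]⟩⟩


/-- The affine equation of `X₁(2,10)`: `y² = x³ + x² - x`. [folklore] -/
theorem equation_X1TwoTen_iff (x y : ℚ) :
    (⟨0, 1, 0, -1, 0⟩ : WeierstrassCurve ℚ).toAffine.Equation x y ↔ y ^ 2 = x ^ 3 + x ^ 2 - x := by
  rw [Affine.equation_iff]
  constructor <;> intro h <;> linear_combination h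

/-- `T = (0, 0)` is a nonsingular point of `X₁(2,10)` (`a₆ = 0`, `a₄ = -1 ≠ 0`). [folklore] -/
theorem X1TwoTen_nonsingular_zero : (⟨0, 1, 0, -1, 0⟩ : WeierstrassCurve ℚ).toAffine.Nonsingular 0 0 := by
  rw [Affine.nonsingular_zero]
  norm_num


/-! ### Integrality bookkeeping on `ℚ` -/

/-- `‖x‖_p ≤ 1` for every prime `p` forces `x ∈ ℤ` (as `max(1, ‖x‖_p) = p ^ ord_p(den x)`).
[folklore] -/
theorem Rat.den_eq_one_of_forall_norm_le_one {x : ℚ}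
    (h : ∀ (p : ℕ) [Fact p.Prime], ‖(x : ℚ_[p])‖ ≤ 1) : x.den = 1 := by
  refine Nat.eq_one_iff_not_exists_prime_dvd.mpr fun p hp hpd => ?_
  haveI : Fact p.Prime := ⟨hp⟩
  have hmax := WeierstrassCurve.max_one_norm_ratCast p x
  rw [max_eq_left (h p)] at hmax
  have hp1 : (1 : ℝ) < p := by exact_mod_cast hp.one_lt
  have hv : ((padicValNat p x.den : ℕ) : ℤ) = 0 :=
    zpow_right_injective₀ (zero_lt_one.trans hp1) hp1.ne'
      (show (p : ℝ) ^ ((padicValNat p x.den : ℕ) : ℤ) = (p : ℝ) ^ (0 : ℤ) by rw [← hmax, zpow_zero])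
  have h0 : padicValNat p x.den = 0 := by exact_mod_cast hv
  rcases padicValNat.eq_zero_iff.mp h0 with h1 | h1 | h1
  · exact hp.ne_one h1
  · exact x.den_nz h1
  · exact h1 hpd

/-- A rational all of whose `p`-adic valuations are non-negative is an integer. [folklore] -/
theorem Rat.den_eq_one_of_forall_padicValRat_nonneg {x : ℚ}
    (h : ∀ p : ℕ, p.Prime → 0 ≤ padicValRat p x) : x.den = 1 := by
  refine Nat.eq_one_iff_not_exists_prime_dvd.mpr fun p hp hpd => ?_
  haveI : Fact p.Prime := ⟨hp⟩
  have hv := h p hp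
  have hcop : ¬ (p : ℤ) ∣ x.num := fun hn =>
    hp.ne_one (Nat.eq_one_of_dvd_coprimes x.reduced (Int.ofNat_dvd_left.mp hn) hpd)
  rw [padicValRat_def, padicValInt.eq_zero_of_not_dvd hcop] at hv
  have hden : 1 ≤ padicValNat p x.den := one_le_padicValNat_of_dvd x.den_nz hpd
  omega

/-- A rational square root of an integer is an integer. [folklore] -/
theorem Rat.den_eq_one_of_sq_eq_intCast {w : ℚ} {n : ℤ} (h : w ^ 2 = n) : w.den = 1 := by
  refine Rat.den_eq_one_of_forall_padicValRat_nonneg fun p hp => ?_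
  haveI : Fact p.Prime := ⟨hp⟩
  have h2 : padicValRat p (w ^ 2) = 2 * padicValRat p w := by
    rw [padicValRat.pow]; rfl
  have hn : 0 ≤ padicValRat p (w ^ 2) := by rw [h]; exact padicValRat_intCast_nonneg n
  omega

/-- `5` is prime (as a `Fact`, for the `padicValRat 5` lemmas). [folklore] -/
theorem fact_prime_five : Fact (Nat.Prime 5) := ⟨Nat.prime_five⟩

/-- A prime `p` with `(p : ℤ) ∣ 5` is `5`. [folklore] -/
theorem eq_five_of_dvd {p : ℕ} (hp : p.Prime) (hd : (p : ℤ) ∣ 5) : p = 5 := by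
  have h5 : p ∣ 5 := by exact_mod_cast hd
  exact (Nat.prime_dvd_prime_iff_eq hp Nat.prime_five).mp h5

/-- `x² + x - 1` has no rational root (`(2x + 1)² = 5` is impossible `5`-adically).
[folklore] -/
theorem Rat.sq_add_self_sub_one_ne_zero (x : ℚ) : x ^ 2 + x - 1 ≠ 0 := by
  haveI := fact_prime_five
  intro h
  have h5 : (2 * x + 1) ^ 2 = 5 := by linear_combination 4 * h
  have hv := congrArg (padicValRat 5) h5
  rw [padicValRat.pow, show (5 : ℚ) = ((5 : ℕ) : ℚ) by norm_num,
    padicValRat.self (by norm_num)] at hv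
  omega

/-- The only integer `u ≥ 0` with `u² + u - 1` a square is `u = 1` (for `u ≥ 2`,
`u² < u² + u - 1 < (u + 1)²`). [folklore] -/
theorem Int.eq_one_of_sq_eq {u j : ℤ} (hu : 0 ≤ u) (h : j ^ 2 = u ^ 2 + u - 1) : u = 1 := by
  rcases lt_trichotomy u 1 with h1 | h1 | h1
  · have : u = 0 := by omega
    subst this
    nlinarith [sq_nonneg j]
  · exact h1
  · have hlow : u ^ 2 < j ^ 2 := by nlinarith
    have hup : j ^ 2 < (u + 1) ^ 2 := by nlinarith
    have h3 : |u| < |j| := sq_lt_sq.mp hlow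
    have h4 : |j| < |u + 1| := sq_lt_sq.mp hup
    rw [abs_of_nonneg hu] at h3
    rw [abs_of_nonneg (by omega : (0 : ℤ) ≤ u + 1)] at h4
    omega

/-! ### Valuation parities on `y² = x³ + ax² + bx` -/

/-- **`v_p(x)` is even away from `b`.** For integers `a, b`, a rational solution of
`y² = x³ + ax² + bx` with `x ≠ 0`, and a prime `p ∤ b`, the valuation `v_p(x)` is even: if
`v_p(x) < 0` then `2v(y) = 3v(x)` (`even_padicValRat_of_neg`); if `v_p(x) > 0` then
`x² + ax + b` is a `p`-unit and `2v(y) = v(x)`. (The computation `α(Γ) ⊆ {±∏ pᵢ^{εᵢ} : pᵢ ∣ b}`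
of the descent via `2`-isogeny, Silverman–Tate III.5: "`x = b₁M²/e²` with `b₁ ∣ b`".)
[folklore] -/
theorem even_padicValRat_of_twoTorsionNF {a b : ℤ} {x y : ℚ}
    (he : y ^ 2 = x ^ 3 + a * x ^ 2 + b * x) (hx : x ≠ 0) {p : ℕ} [Fact p.Prime]
    (hpb : ¬ (p : ℤ) ∣ b) : Even (padicValRat p x) := by
  set v := padicValRat p x with hv
  rcases lt_trichotomy v 0 with hneg | hzero | hpos
  · exact even_padicValRat_of_neg (a₁ := 0) (a₂ := a) (a₃ := 0) (a₄ := b) (a₆ := 0) (x := x)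
      (y := y) (by push_cast; linear_combination he) hneg
  · exact ⟨0, by omega⟩
  · have hb0 : (b : ℚ) ≠ 0 := by
      have : b ≠ 0 := fun h0 => hpb (h0 ▸ dvd_zero _)
      exact_mod_cast this
    have hvb : padicValRat p (b : ℚ) = 0 := padicValRat_intCast_eq_zero hpb
    -- `x² + ax = x (x + a)` is `0` or has valuation `> 0 = v(b)`
    have hxa : x * (x + a) = 0 ∨ padicValRat p (b : ℚ) < padicValRat p (x * (x + a)) := by
      by_cases h0 : x + a = 0
      · exact Or.inl (by rw [h0, mul_zero])
      · refine Or.inr ?_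
        have h1 : x + (a : ℚ) = 0 ∨ 0 ≤ padicValRat p (x + a) :=
          le_padicValRat_add_or (Or.inr (by omega)) (by
            by_cases ha : (a : ℚ) = 0
            · exact Or.inl ha
            · exact Or.inr (padicValRat_intCast_nonneg a))
        rw [hvb, padicValRat.mul hx h0]
        have := h1.resolve_left h0
        omega
    obtain ⟨hq0, hq⟩ := padicValRat_add_eq_left (p := p) hb0 hxa
    have hfac : x ^ 3 + a * x ^ 2 + b * x = x * ((b : ℚ) + x * (x + a)) := by ring
    rw [hfac] at he
    have hy0 : y ≠ 0 := by
      rintro rfl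
      exact mul_ne_zero hx hq0 (by simpa using he.symm)
    have hval := congrArg (padicValRat p) he
    rw [padicValRat.pow, padicValRat.mul hx hq0, hq, hvb, add_zero] at hval
    exact ⟨padicValRat p y, by simp only [← hv] at hval; omega⟩

/-! ### The descent hypotheses for `X₁(2,10)` and its `2`-isogenous curve -/

/-- **`α(X₁(2,10)(ℚ)) ⊆ {[1], [-1]}`**: on `y² = x³ + x² - x` (`b = -1`), every rational point
with `x ≠ 0` has `x` or `-x = b·x` a rational square, since `v_p(x)` is even for every prime
`p` (`p ∤ b = -1`). [folklore] -/
theorem X1TwoTen_sq_or_neg_sq {x y : ℚ} (h : (⟨0, 1, 0, -1, 0⟩ : WeierstrassCurve ℚ).toAffine.Nonsingular x y) (hx : x ≠ 0) :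
    ∃ w : ℚ, x = w ^ 2 ∨ (⟨0, 1, 0, -1, 0⟩ : WeierstrassCurve ℚ).a₄ * x = w ^ 2 := by
  have he : y ^ 2 = x ^ 3 + ((1 : ℤ) : ℚ) * x ^ 2 + ((-1 : ℤ) : ℚ) * x := by
    have := (equation_X1TwoTen_iff x y).mp h.1
    push_cast; linear_combination this
  have heven : ∀ p : ℕ, p.Prime → Even (padicValRat p |x|) := fun p hp => by
    haveI : Fact p.Prime := ⟨hp⟩
    have hpb : ¬ (p : ℤ) ∣ (-1 : ℤ) := fun hd => hp.ne_one (by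
      have := Int.eq_one_of_dvd_one (by positivity) (dvd_neg.mp hd)
      exact_mod_cast this)
    have := even_padicValRat_of_twoTorsionNF he hx hpb
    rcases abs_choice x with habs | habs <;> rw [habs]
    · exact this
    · rwa [padicValRat.neg]
  obtain ⟨r, hr⟩ := exists_sq_of_even_padicValRat (abs_pos.mpr hx) heven
  rcases abs_choice x with habs | habs
  · exact ⟨r, Or.inl (by rw [← habs, hr])⟩
  · exact ⟨r, Or.inr (by rw [← hr, habs]; ring)⟩

/-- **`α'(E₂(ℚ)) ⊆ {[1], [5]}`** for the `2`-isogenous curve `E₂ : Y² = X³ - 2X² + 5X` of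
`X₁(2,10)`: every rational point with `X ≠ 0` has `X > 0` (`X³ - 2X² + 5X = X((X-1)² + 4)`)
and `v_p(X)` even for `p ≠ 5`, so `X` or `5X = (a² - 4b)X` is a rational square according to the
parity of `v₅(X)`. (The local computation of the descent: only signs and the prime `5 ∣ b'`
enter.) [folklore] -/
theorem X1TwoTen_codomain_sq_or_five_mul_sq {X Y : ℚ}
    (h : (⟨0, 1, 0, -1, 0⟩ : WeierstrassCurve ℚ).twoIsogenyCodomain.toAffine.Nonsingular X Y) (hX : X ≠ 0) :
    ∃ w : ℚ, X = w ^ 2 ∨ ((⟨0, 1, 0, -1, 0⟩ : WeierstrassCurve ℚ).a₂ ^ 2 - 4 * (⟨0, 1, 0, -1, 0⟩ : WeierstrassCurve ℚ).a₄) * X = w ^ 2 := by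
  haveI := fact_prime_five
  have he : Y ^ 2 = X ^ 3 + ((-2 : ℤ) : ℚ) * X ^ 2 + ((5 : ℤ) : ℚ) * X := by
    have := WeierstrassCurve.rel_of_nonsingular (⟨0, 1, 0, -1, 0⟩ : WeierstrassCurve ℚ).twoIsogenyCodomain h
    simp only [twoIsogenyCodomain_a₂, twoIsogenyCodomain_a₄] at this
    push_cast; linear_combination this
  -- positivity
  have hpos : 0 < X := by
    have hq : 0 < (X - 1) ^ 2 + 4 := by positivity
    have hprod : X * ((X - 1) ^ 2 + 4) = Y ^ 2 := by push_cast at he; linear_combination -he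
    by_contra hle
    have hlt : X < 0 := lt_of_le_of_ne (not_lt.mp hle) hX
    nlinarith [sq_nonneg Y, mul_neg_of_neg_of_pos hlt hq]
  -- parities away from `5`
  have heven : ∀ p : ℕ, p.Prime → p ≠ 5 → Even (padicValRat p X) := fun p hp hp5 => by
    haveI : Fact p.Prime := ⟨hp⟩
    exact even_padicValRat_of_twoTorsionNF he hX fun hd => hp5 (eq_five_of_dvd hp hd)
  have hcoef : (⟨0, 1, 0, -1, 0⟩ : WeierstrassCurve ℚ).a₂ ^ 2 - 4 * (⟨0, 1, 0, -1, 0⟩ : WeierstrassCurve ℚ).a₄ = 5 := by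
    norm_num
  rw [hcoef]
  by_cases h5 : Even (padicValRat 5 X)
  · obtain ⟨r, hr⟩ := exists_sq_of_even_padicValRat hpos fun p hp => by
      by_cases hp5 : p = 5
      · subst hp5; exact h5
      · exact heven p hp hp5
    exact ⟨r, Or.inl hr⟩
  · obtain ⟨r, hr⟩ := exists_sq_of_even_padicValRat (mul_pos (by norm_num : (0:ℚ) < 5) hpos)
      fun p hp => by
        haveI : Fact p.Prime := ⟨hp⟩
        rw [padicValRat.mul (by norm_num) hX]
        by_cases hp5 : p = 5
        · subst hp5
          rw [show (5 : ℚ) = ((5 : ℕ) : ℚ) by norm_num, padicValRat.self (by norm_num)]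
          rcases Int.even_or_odd (padicValRat 5 X) with h' | h'
          · exact absurd h' h5
          · obtain ⟨k, hk⟩ := h'
            exact ⟨k + 1, by omega⟩
        · have h50 : padicValRat p (5 : ℚ) = 0 := by
            rw [show (5 : ℚ) = ((5 : ℤ) : ℚ) by norm_num]
            exact padicValRat_intCast_eq_zero fun hd => hp5 (eq_five_of_dvd hp hd)
          rw [h50, zero_add]
          exact heven p hp hp5
    exact ⟨r, Or.inr hr⟩

/-! ### `X₁(2,10)(ℚ)` is finite (rank `0`) -/

/-- **`X₁(2,10)(ℚ)` is finite**: descent via `2`-isogeny (`finite_point_of_twoIsogenyDescent`,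
with `α ⊆ {[1],[-1]}`, `α' ⊆ {[1],[5]}`) and the Mordell–Weil theorem. In Cremona's tables
this is "`20A`: `r = 0`". [folklore] -/
theorem finite_point_X1TwoTen : Finite (⟨0, 1, 0, -1, 0⟩ : WeierstrassCurve ℚ).toAffine.Point := by
  haveI := isElliptic_X1TwoTen
  exact finite_point_of_twoIsogenyDescent (⟨0, 1, 0, -1, 0⟩ : WeierstrassCurve ℚ) (fun h hx => X1TwoTen_sq_or_neg_sq h hx)
    (fun h hX => X1TwoTen_codomain_sq_or_five_mul_sq h hX)

/-! ### The group law on `X₁(2,10)(ℚ)` in coordinates -/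

/-- `-(x, y) = (x, -y)` on `X₁(2,10)` (`a₁ = a₃ = 0`). [folklore] -/
theorem X1TwoTen_negY (x y : ℚ) : (⟨0, 1, 0, -1, 0⟩ : WeierstrassCurve ℚ).toAffine.negY x y = -y := by
  rw [Affine.negY, toAffine_a₁, toAffine_a₃]; ring

/-- The curve equation from nonsingularity. [folklore] -/
theorem X1TwoTen_rel {x y : ℚ} (h : (⟨0, 1, 0, -1, 0⟩ : WeierstrassCurve ℚ).toAffine.Nonsingular x y) :
    y ^ 2 = x ^ 3 + x ^ 2 - x :=
  (equation_X1TwoTen_iff x y).mp h.1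

/-- `T + T = O` for `T = (0, 0)`. [folklore] -/
theorem X1TwoTen_T_add_T : (Affine.Point.some 0 0 X1TwoTen_nonsingular_zero : (⟨0, 1, 0, -1, 0⟩ : WeierstrassCurve ℚ).toAffine.Point) + (Affine.Point.some 0 0 X1TwoTen_nonsingular_zero : (⟨0, 1, 0, -1, 0⟩ : WeierstrassCurve ℚ).toAffine.Point) = 0 := by
  exact Affine.Point.add_self_of_Y_eq (by rw [X1TwoTen_negY, neg_zero])

/-- **The only rational `2`-torsion point of `X₁(2,10)` is `T = (0, 0)`** (the other roots of
`x³ + x² - x` are `(-1 ± √5)/2`). [folklore] -/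
theorem X1TwoTen_eq_T_of_add_self {P : (⟨0, 1, 0, -1, 0⟩ : WeierstrassCurve ℚ).toAffine.Point} (h2 : P + P = 0) (h0 : P ≠ 0) :
    P = (Affine.Point.some 0 0 X1TwoTen_nonsingular_zero : (⟨0, 1, 0, -1, 0⟩ : WeierstrassCurve ℚ).toAffine.Point) := by
  rcases P with _ | ⟨x, y, h⟩
  · exact absurd rfl h0
  have hy : y = (⟨0, 1, 0, -1, 0⟩ : WeierstrassCurve ℚ).toAffine.negY x y := by
    by_contra hy
    rw [Affine.Point.add_self_of_Y_ne hy] at h2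
    exact Affine.Point.some_ne_zero _ h2
  rw [X1TwoTen_negY] at hy
  have hy0 : y = 0 := by linarith
  have e := X1TwoTen_rel h
  rw [hy0] at e
  have hx : x * (x ^ 2 + x - 1) = 0 := by linear_combination -e
  rcases mul_eq_zero.mp hx with hx0 | hx0
  · subst hx0 hy0; rfl
  · exact absurd hx0 (Rat.sq_add_self_sub_one_ne_zero x)

/-- **Duplication on `X₁(2,10)`**: `x(2P) · (2y)² = (x² + 1)²` for `P = (x, y)` with `y ≠ 0`
(Silverman, *AEC*, III.2.3(d) with `b = -1`). [folklore] -/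
theorem X1TwoTen_addX_self_mul {x y : ℚ} (h : (⟨0, 1, 0, -1, 0⟩ : WeierstrassCurve ℚ).toAffine.Nonsingular x y)
    (hy : y ≠ (⟨0, 1, 0, -1, 0⟩ : WeierstrassCurve ℚ).toAffine.negY x y) :
    (⟨0, 1, 0, -1, 0⟩ : WeierstrassCurve ℚ).toAffine.addX x x ((⟨0, 1, 0, -1, 0⟩ : WeierstrassCurve ℚ).toAffine.slope x x y y) * (2 * y) ^ 2 =
      (x ^ 2 + 1) ^ 2 := by
  have e := X1TwoTen_rel h
  have hy2 : y - (⟨0, 1, 0, -1, 0⟩ : WeierstrassCurve ℚ).toAffine.negY x y = 2 * y := by rw [X1TwoTen_negY]; ring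
  have hℓ : (⟨0, 1, 0, -1, 0⟩ : WeierstrassCurve ℚ).toAffine.slope x x y y * (2 * y) = 3 * x ^ 2 + 2 * x - 1 := by
    rw [Affine.slope_of_Y_ne rfl hy, hy2, toAffine_a₁, toAffine_a₂, toAffine_a₄,
      div_mul_cancel₀ _ (by rw [← hy2]; exact sub_ne_zero.mpr hy)]
    ring
  set ℓ := (⟨0, 1, 0, -1, 0⟩ : WeierstrassCurve ℚ).toAffine.slope x x y y
  rw [Affine.addX, toAffine_a₁, toAffine_a₂]
  linear_combination (2 * y * ℓ + (3 * x ^ 2 + 2 * x - 1)) * hℓ - 4 * (1 + 2 * x) * e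

/-- **No rational point `Q` with `2Q = T`** on `X₁(2,10)` (`b = -1` is not a square: by the
duplication formula `x(2Q) = 0` would force `(x² + 1)² = 0`). This is "`T ∉ 2Γ`", i.e. no
rational `4`-torsion through `T`. [folklore] -/
theorem X1TwoTen_add_self_ne_T (Q : (⟨0, 1, 0, -1, 0⟩ : WeierstrassCurve ℚ).toAffine.Point) : Q + Q ≠ (Affine.Point.some 0 0 X1TwoTen_nonsingular_zero : (⟨0, 1, 0, -1, 0⟩ : WeierstrassCurve ℚ).toAffine.Point) := by
  intro hQ
  rcases Q with _ | ⟨x, y, h⟩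
  · rw [← Affine.Point.zero_def, add_zero] at hQ
    exact (Affine.Point.some_ne_zero _) hQ.symm
  by_cases hy : y = (⟨0, 1, 0, -1, 0⟩ : WeierstrassCurve ℚ).toAffine.negY x y
  · rw [Affine.Point.add_self_of_Y_eq hy] at hQ
    exact (Affine.Point.some_ne_zero _) hQ.symm
  · have key := X1TwoTen_addX_self_mul h hy
    rw [Affine.Point.add_self_of_Y_ne hy, Affine.Point.some.injEq] at hQ
    rw [hQ.1, zero_mul] at key
    have : x ^ 2 + 1 = 0 := pow_eq_zero_iff two_ne_zero |>.mp key.symm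
    nlinarith [sq_nonneg x]

/-- `T + (x, y) = (-1/x, y/x²)` for `x ≠ 0` (translation by the `2`-torsion point; `b = -1`).
[folklore] -/
theorem X1TwoTen_T_add_some {x y : ℚ} (h : (⟨0, 1, 0, -1, 0⟩ : WeierstrassCurve ℚ).toAffine.Nonsingular x y) (hx : x ≠ 0) :
    ∃ h', (Affine.Point.some 0 0 X1TwoTen_nonsingular_zero : (⟨0, 1, 0, -1, 0⟩ : WeierstrassCurve ℚ).toAffine.Point) + .some x y h = .some (-1 / x) (y / x ^ 2) h' := by
  have e := X1TwoTen_rel h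
  have hx' : (0 : ℚ) ≠ x := fun h0 => hx h0.symm
  have hL : (0 - y) / (0 - x) = y / x := by rw [zero_sub, zero_sub, neg_div_neg_eq]
  rw [Affine.Point.add_of_X_ne hx']
  refine some_eq_some_of_eq _ ?_ ?_
  · rw [Affine.addX, Affine.slope_of_X_ne hx', hL, toAffine_a₁, toAffine_a₂]
    field_simp
    linear_combination e
  · rw [Affine.addY, X1TwoTen_negY, Affine.negAddY, Affine.addX, Affine.slope_of_X_ne hx', hL,
      toAffine_a₁, toAffine_a₂]
    field_simp
    linear_combination -y * e

/-! ### The rational points of `X₁(2,10)` -/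

/-- **`X₁(2,10)(ℚ) = 2·X₁(2,10)(ℚ) + {O, T}`** with Mathlib's (decidable-equality–`ℚ`) group law:
the descent lemma `exists_eq_two_smul_or` specialised to `X₁(2,10)` (the generic files use the
classical instance; the two group laws agree). [folklore] -/
theorem X1TwoTen_exists_eq_two_smul_or (P : (⟨0, 1, 0, -1, 0⟩ : WeierstrassCurve ℚ).toAffine.Point) :
    ∃ Q : (⟨0, 1, 0, -1, 0⟩ : WeierstrassCurve ℚ).toAffine.Point, P = Q + Q ∨ P = Q + Q + (Affine.Point.some 0 0 X1TwoTen_nonsingular_zero : (⟨0, 1, 0, -1, 0⟩ : WeierstrassCurve ℚ).toAffine.Point) := by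
  haveI := isElliptic_X1TwoTen
  obtain ⟨Q, hQ⟩ := (⟨0, 1, 0, -1, 0⟩ : WeierstrassCurve ℚ).exists_eq_two_smul_or (fun h hx => X1TwoTen_sq_or_neg_sq h hx)
    (fun h hX => X1TwoTen_codomain_sq_or_five_mul_sq h hX) P
  refine ⟨Q, ?_⟩
  have h2 : ∀ (d : DecidableEq ℚ) (R : (⟨0, 1, 0, -1, 0⟩ : WeierstrassCurve ℚ).toAffine.Point),
      (letI : DecidableEq ℚ := d; (2 • R :)) = @HAdd.hAdd _ _ _ (@instHAdd _
        (@WeierstrassCurve.Affine.Point.instAdd ℚ _ (⟨0, 1, 0, -1, 0⟩ : WeierstrassCurve ℚ).toAffine instDecidableEqRat)) R R := by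
    intro d R
    have hd : d = instDecidableEqRat := Subsingleton.elim _ _
    subst hd
    exact two_nsmul R
  rw [h2 _ Q] at hQ
  rcases hQ with hQ | hQ
  · exact Or.inl hQ
  · rw [point_add_irrel (fun a b => Classical.propDecidable (a = b)) instDecidableEqRat] at hQ
    exact Or.inr hQ

/-- **Odd-order rational points of `X₁(2,10)` have integral abscissa** (Nagell–Lutz style):
for a rational point `P₀ = (x₀, y₀)` of odd order `m`, `‖x₀‖_p ≤ 1` at every prime `p` — at
`p = 2` because `m`-torsion with `‖m‖₂ = 1` is `2`-integral (`val_le_one_of_zsmul_eq_zero`,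
Silverman *AEC* VII.3.1), at odd `p` because `E₁(ℚ_p) ∩ E(ℚ)` is torsion-free
(`not_isOfFinAddOrder_of_one_lt_padicNorm_of_isIntegral`, *AEC* VII.3.4). [folklore] -/
theorem X1TwoTen_norm_le_one_of_odd {x₀ y₀ : ℚ} {h₀ : (⟨0, 1, 0, -1, 0⟩ : WeierstrassCurve ℚ).toAffine.Nonsingular x₀ y₀}
    (hfin : IsOfFinAddOrder (.some x₀ y₀ h₀ : (⟨0, 1, 0, -1, 0⟩ : WeierstrassCurve ℚ).toAffine.Point))
    (hodd : Odd (addOrderOf (.some x₀ y₀ h₀ : (⟨0, 1, 0, -1, 0⟩ : WeierstrassCurve ℚ).toAffine.Point)))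
    (p : ℕ) [Fact p.Prime] : ‖(x₀ : ℚ_[p])‖ ≤ 1 := by
  haveI := isElliptic_X1TwoTen
  haveI := isIntegral_X1TwoTen
  by_cases hp2 : p = 2
  · subst hp2
    haveI : (⟨0, 1, 0, -1, 0⟩ : WeierstrassCurve ℚ).IsIntegral (ratAdicValuation 2).integer :=
      (⟨0, 1, 0, -1, 0⟩ : WeierstrassCurve ℚ).isIntegral_integer_ratAdicValuation 2
    set m := addOrderOf (.some x₀ y₀ h₀ : (⟨0, 1, 0, -1, 0⟩ : WeierstrassCurve ℚ).toAffine.Point) with hm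
    have hm0 : m • (.some x₀ y₀ h₀ : (⟨0, 1, 0, -1, 0⟩ : WeierstrassCurve ℚ).toAffine.Point) = 0 := addOrderOf_nsmul_eq_zero _
    have hmz : (m : ℤ) • (.some x₀ y₀ h₀ : (⟨0, 1, 0, -1, 0⟩ : WeierstrassCurve ℚ).toAffine.Point) = 0 := by
      rw [natCast_zsmul]; exact hm0
    have hmz' := (point_zsmul_irrel (instDecidableEqRat)
      (fun a b => Classical.propDecidable (a = b)) (m : ℤ)
      (.some x₀ y₀ h₀ : (⟨0, 1, 0, -1, 0⟩ : WeierstrassCurve ℚ).toAffine.Point)).symm.trans hmz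
    have hw : ratAdicValuation 2 (((m : ℕ) : ℤ) : ℚ) = 1 := by
      rw [ratAdicValuation_apply, ← NNReal.coe_eq_one, coe_nnnorm, Int.cast_natCast,
        Rat.cast_natCast, Padic.norm_natCast_eq_one_iff]
      exact Nat.coprime_two_left.mpr hodd
    have := val_le_one_of_zsmul_eq_zero (V := (⟨0, 1, 0, -1, 0⟩ : WeierstrassCurve ℚ)) hw hmz'
    rw [ratAdicValuation_apply, ← NNReal.coe_le_coe, NNReal.coe_one, coe_nnnorm] at this
    exact this
  · have hp3 : 3 ≤ p := by
      have h2 := (Fact.out : p.Prime).two_le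
      omega
    by_contra h1
    exact not_isOfFinAddOrder_of_one_lt_padicNorm_of_isIntegral (⟨0, 1, 0, -1, 0⟩ : WeierstrassCurve ℚ) p hp3 h₀
      (not_le.mp h1) hfin

/-- **In `X₁(2,10)(ℚ)` the double of any point has odd order**: otherwise a suitable multiple
`R = j·(2Q)` would have order `2`, so `R = T` (`X1TwoTen_eq_T_of_add_self`), i.e.
`T = 2(jQ)`, contradicting `X1TwoTen_add_self_ne_T`. [folklore] -/
theorem X1TwoTen_odd_addOrderOf_add_self [Finite (⟨0, 1, 0, -1, 0⟩ : WeierstrassCurve ℚ).toAffine.Point]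
    (Q : (⟨0, 1, 0, -1, 0⟩ : WeierstrassCurve ℚ).toAffine.Point) : Odd (addOrderOf (Q + Q)) := by
  by_contra heven
  rw [Nat.not_odd_iff_even] at heven
  obtain ⟨j, hj⟩ := heven
  have hpos : 0 < addOrderOf (Q + Q) := (isOfFinAddOrder_of_finite _).addOrderOf_pos
  have hj0 : j ≠ 0 := by rintro rfl; omega
  have hR : addOrderOf (j • (Q + Q)) = 2 := by
    rw [addOrderOf_nsmul' (Q + Q) hj0, hj, ← two_mul, Nat.gcd_mul_left_left,
      Nat.mul_div_cancel _ (Nat.pos_of_ne_zero hj0)]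
  have hR0 : j • (Q + Q) ≠ 0 := by
    intro h0
    rw [h0, addOrderOf_zero] at hR
    exact absurd hR (by norm_num)
  have hR2 : j • (Q + Q) + j • (Q + Q) = 0 := by
    rw [← two_nsmul, ← hR]; exact addOrderOf_nsmul_eq_zero _
  have hT := X1TwoTen_eq_T_of_add_self hR2 hR0
  rw [nsmul_add] at hT
  exact X1TwoTen_add_self_ne_T (j • Q) hT

/-- **The rational points of `X₁(2,10)`: `y² = x³ + x² - x` has only the solutions with
`x ∈ {0, 1, -1}`**, i.e. `X₁(2,10)(ℚ) = {O, (0,0), (1,±1), (-1,±1)} ≅ ℤ/6` consists of the six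
rational cusps (Cremona's Table 1, class `20A`: `r = 0`, `|T| = 6`; Kubert 1976, Ch. IV). Proof:
`X₁(2,10)(ℚ)` is finite (`finite_point_X1TwoTen`: `2`-isogeny descent + Mordell–Weil); write a
rational point as `P = 2Q` or `2Q + T` (`X1TwoTen_exists_eq_two_smul_or`); `P₀ = 2Q` has odd
order, hence integral abscissa `x₀` (`X1TwoTen_norm_le_one_of_odd`), and `x₀ = w²` by the
duplication formula, so `w ∈ ℤ`, `v = y₀/w ∈ ℤ` with `v² = w⁴ + w² - 1`, forcing `w² = 1`
(`Int.eq_one_of_sq_eq`); thus `P₀ ∈ {O, (1, ±1)}` and `P ∈ P₀ + {O, T}` has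
`x(P) ∈ {0, 1, -1}`. [folklore] -/
theorem X1TwoTen_points (x y : ℚ) (hxy : y ^ 2 = x ^ 3 + x ^ 2 - x) :
    x = 0 ∨ x = 1 ∨ x = -1 := by
  haveI := isElliptic_X1TwoTen
  haveI := finite_point_X1TwoTen
  have hfin : ∀ R : (⟨0, 1, 0, -1, 0⟩ : WeierstrassCurve ℚ).toAffine.Point, IsOfFinAddOrder R := fun R =>
    isOfFinAddOrder_of_finite R
  have hns : (⟨0, 1, 0, -1, 0⟩ : WeierstrassCurve ℚ).toAffine.Nonsingular x y :=
    Affine.equation_iff_nonsingular.mp ((equation_X1TwoTen_iff x y).mpr hxy)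
  obtain ⟨Q, hQ⟩ := X1TwoTen_exists_eq_two_smul_or (.some x y hns)
  obtain ⟨P₀, hP₀⟩ : ∃ P₀ : (⟨0, 1, 0, -1, 0⟩ : WeierstrassCurve ℚ).toAffine.Point, P₀ = Q + Q := ⟨_, rfl⟩
  rw [← hP₀] at hQ
  have hodd : Odd (addOrderOf P₀) := hP₀ ▸ X1TwoTen_odd_addOrderOf_add_self Q
  -- `P₀ = O` or `P₀ = (1, y₀)`
  have hcases : P₀ = 0 ∨ ∃ (y₀ : ℚ) (h₀ : (⟨0, 1, 0, -1, 0⟩ : WeierstrassCurve ℚ).toAffine.Nonsingular 1 y₀),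
      P₀ = .some 1 y₀ h₀ := by
    rcases hP : P₀ with _ | ⟨x₀, y₀, h₀⟩
    · exact Or.inl rfl
    right
    rw [hP] at hP₀ hodd
    -- `Q = (x₁, y₁)` with `y₁ ≠ 0`, and `x₀ = x(2Q)` is a square
    rcases Q with _ | ⟨x₁, y₁, h₁⟩
    · rw [← Affine.Point.zero_def, add_zero] at hP₀
      exact absurd hP₀ (Affine.Point.some_ne_zero _)
    by_cases hy₁ : y₁ = (⟨0, 1, 0, -1, 0⟩ : WeierstrassCurve ℚ).toAffine.negY x₁ y₁
    · rw [Affine.Point.add_self_of_Y_eq hy₁] at hP₀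
      exact absurd hP₀ (Affine.Point.some_ne_zero _)
    have key := X1TwoTen_addX_self_mul h₁ hy₁
    rw [Affine.Point.add_self_of_Y_ne hy₁, Affine.Point.some.injEq] at hP₀
    rw [← hP₀.1] at key
    have hy₁0 : y₁ ≠ 0 := by
      intro h0; apply hy₁; rw [X1TwoTen_negY, h0, neg_zero]
    obtain ⟨w, hw⟩ : ∃ w : ℚ, w = (x₁ ^ 2 + 1) / (2 * y₁) := ⟨_, rfl⟩
    have hsq : x₀ = w ^ 2 := by
      rw [hw, div_pow, eq_div_iff (pow_ne_zero 2 (mul_ne_zero two_ne_zero hy₁0))]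
      linear_combination key
    -- integrality of `x₀`, `w` and `v = y₀ / w`
    have hden : x₀.den = 1 :=
      Rat.den_eq_one_of_forall_norm_le_one fun p _ => X1TwoTen_norm_le_one_of_odd (hfin _) hodd p
    have hx₀Z : ((x₀.num : ℤ) : ℚ) = x₀ := Rat.coe_int_num_of_den_eq_one hden
    have hwden : w.den = 1 := Rat.den_eq_one_of_sq_eq_intCast (n := x₀.num) (by rw [hx₀Z, hsq])
    have hwZ : ((w.num : ℤ) : ℚ) = w := Rat.coe_int_num_of_den_eq_one hwden
    have e₀ := X1TwoTen_rel h₀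
    have hx₀0 : x₀ ≠ 0 := by
      rintro rfl
      have hy₀ : y₀ = 0 := by simpa using e₀
      subst hy₀
      apply X1TwoTen_add_self_ne_T (.some x₁ y₁ h₁)
      rw [Affine.Point.add_self_of_Y_ne hy₁]
      exact (some_eq_some_of_eq _ hP₀.1 hP₀.2).choose_spec ▸ rfl
    have hw0 : w ≠ 0 := by rintro rfl; exact hx₀0 (by rw [hsq]; ring)
    have hv : (y₀ / w) ^ 2 = x₀ ^ 2 + x₀ - 1 := by
      rw [div_pow, div_eq_iff (pow_ne_zero 2 hw0)]
      linear_combination e₀ + (x₀ ^ 2 + x₀ - 1) * hsq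
    have hvden : (y₀ / w).den = 1 :=
      Rat.den_eq_one_of_sq_eq_intCast (n := x₀.num ^ 2 + x₀.num - 1) (by
        rw [hv]; push_cast; rw [hx₀Z])
    have hvZ : (((y₀ / w).num : ℤ) : ℚ) = y₀ / w := Rat.coe_int_num_of_den_eq_one hvden
    -- the integer equation `v² = k⁴ + k² - 1`, `x₀ = k²`
    have hk : x₀ = ((w.num : ℤ) : ℚ) ^ 2 := by rw [hwZ, hsq]
    have hZ : ((y₀ / w).num : ℤ) ^ 2 = (w.num ^ 2) ^ 2 + w.num ^ 2 - 1 := by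
      have : ((((y₀ / w).num : ℤ) : ℚ)) ^ 2 = (((w.num : ℤ) : ℚ) ^ 2) ^ 2 +
          ((w.num : ℤ) : ℚ) ^ 2 - 1 := by rw [hvZ, hv, hk]
      exact_mod_cast this
    have hk1 : w.num ^ 2 = 1 := Int.eq_one_of_sq_eq (sq_nonneg _) hZ
    have hx₀1 : x₀ = 1 := by
      rw [hk]
      exact_mod_cast hk1
    subst hx₀1
    exact ⟨y₀, h₀, rfl⟩
  -- conclusion
  rcases hQ with hPQ | hPQ
  · rcases hcases with h0 | ⟨y₀, h₀, h1⟩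
    · rw [h0] at hPQ
      exact absurd hPQ (Affine.Point.some_ne_zero _)
    · rw [h1, Affine.Point.some.injEq] at hPQ
      exact Or.inr (Or.inl hPQ.1)
  · rcases hcases with h0 | ⟨y₀, h₀, h1⟩
    · rw [h0, zero_add, Affine.Point.some.injEq] at hPQ
      exact Or.inl hPQ.1
    · obtain ⟨h', e⟩ := X1TwoTen_T_add_some h₀ one_ne_zero
      rw [h1, add_comm, e, Affine.Point.some.injEq] at hPQ
      exact Or.inr (Or.inr (by rw [hPQ.1]; norm_num))

/-! ### The discharge -/

variable (W : WeierstrassCurve ℚ) in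
/-- **Kubert (1976): no elliptic curve over `ℚ` has `ℤ/2ℤ × ℤ/10ℤ ⊆ E(ℚ)`** — discharge of the
named fact `Kubert1976_no_two_ten W` of `MazurTorsion.lean` (D. S. Kubert, *Universal bounds on the
torsion of elliptic curves*, Proc. London Math. Soc. (3) 33 (1976) 193–237, Ch. IV: the modular
curve `X₁(2,10)` has only cuspidal rational points; quoted by Mazur 1977, Ch. III §5, p. 156, in
the passage from Cor. (5.2) to Thm. (5.1)). Proof: `Kubert1976_no_two_ten_of_points`
(`KubertTwoTen.lean`: a subgroup `ℤ/2ℤ × ℤ/10ℤ` gives, via the Tate normal form and Kubert's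
parametrisation of `X₁(10)`, a rational point of `y² = x³ + x² - x` with `x ∉ {0, 1, -1}`)
and `X1TwoTen_points` (this file: that curve has rank `0` by descent via `2`-isogeny and the
Mordell–Weil theorem, and its torsion is the six cusps by `p`-adic integrality of torsion).
[cite: Kubert1976, Ch. IV (X₁(2,10)); Mazur1977, Ch. III §5 p. 156] -/
theorem Kubert1976_no_two_ten_holds : Kubert1976_no_two_ten W :=
  Kubert1976_no_two_ten_of_points X1TwoTen_points W

end Literature.NumberTheory.EllipticCurves

end
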